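import Summits.Schanuel.Schanuel.Theorems.RootDecomp1KCor52Holds03

/-!
# RootDecomp1KCor52Holds — lens 6, generation 21 «GENERAL COR. 5.2, HYPOTHESIS-FREE» (RULE K-R29 (i), FRAME G21, LANE T): the registered Literature named fact `Literature.Barriers.Schanuel.NesterenkoPhilippon2001_ch3_cor_5_2` (LNM 1752 Ch. 3 Cor. 5.2 in PRINT GENERALITY: every q with 0 < |q| < 1, every ξ ∈ ℂ³ over which q, P(q), Q(q), R(q) are algebraic) DISCHARGED BY NAME — `theorem NesterenkoPhilippon2001_ch3_cor_5_2_holds : NesterenkoPhilippon2001_ch3_cor_5_2` from tree theorems only (Thm 1.1, Thm 5.1 at r = 3, Props 4.8 / 4.11, the norm step of p. 47) — continuation (RootDecomp1KCor52Holds04): §4e norm step, algebraic half `norm_step_algebra`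

(lens-6 g21 HOME kernel Cor52.lean 7faa26d9…, 1013 l, ONE import = tree RootDecomp1KPiScale01, namespace `Summit.Schanuel.Schanuel.Theorems.RootDecomp1KCor52`; CLAIM L2014, FRAME G21 L2016, NODE L2073 / RESULT L2074, critic VERDICT L2077 (crit g8: CLEARED — THEOREM ×1, the registered Literature fact discharged BY NAME in print generality; lens-6 tally THEOREM ×4 + CELL ×3; PORT NOW Summit-side, `--supports stmt-Schanuel-33363` = the PiCells/Hyper consumers it un-conditions; Literature relocation = later ops hoist of the four Summit helpers); Summit-side home because the kernel uses Summit helpers (`mvlen` algebra Hyper03/42, det bounds Hyper47, `natAbs_coeff_sup_le_mvlen` PiCells, `norm_mvaeval_le_mvlen_mul_pow` RelLiouvilleCell01) — NODE-g21.md §5; port by census-1 gen 18 as `RootDecomp1KCor52Holds01`–`05`: 01 = §1 transcendence-degree bookkeeping (`Kq`, `Lq`, `bookkeeping`) + §2 a dependent Ramanujan point lies on a prime form (`exists_prime_form_of_dependent`, `span_prime_form`); 02 = §3 the measure (31) at EVERY dependent Ramanujan point (`measure31_of_dependent`); 03 = §4 norm-step algebra (`exists_int_frac`, `exists_common_den`,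 `EB` entry bounds, `wt`, `matA`, `EB_matA`, `det_matA_bounds`) + §4d the evaluation identity (`ringHom_aeval_eq_sum`, `mapMatrix_matA`); 04 = §4e `norm_step_algebra` (B := det 𝔄_A, B(ω) = δ^{nD}·N_{L/K}(A(ξ))); 05 = §4e `norm_step` (analysis) + §5 `NesterenkoPhilippon2001_ch3_cor_5_2_holds` and the binder-free `{π, e^π, Γ(1/4)}` clause `NesterenkoPhilippon2001_ch3_cor_5_2_pi`.
PORT EDITS: `set_option linter.dupNamespace false` dropped; twelve one-line docstrings added; six generic helpers made `private` (`trdeg_adjoin_le_of_isAlgebraic`, `isAlgebraic_of_mem_adjoin`, `four_le_trdeg_of_algebraicIndependent`, `one_le_log_of_exp_le`, `ringHom_mvaeval`, `mapMatrix_smul` — tree twins exist) with per-part private copies; the three scoped `synthInstance.maxHeartbeats 400000 in` and `attribute [local instance] MvPolynomial.gradedAlgebra` kept in 01–02 (precedent PiScale01); statements and proofs verbatim EXCEPT the reviewer's revision of part 03 (review of p827651): `def wt` / `wt_le_totalDegree` deleted in favour of Mathlib's `Finsupp.degree` (`α.degree` in `matA`, `EB_matA`, `mapMatrix_matA`, `norm_step`;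 `rw [Finsupp.degree_eq_sum, Fin.sum_univ_three]` where the three-term form is needed) and the unused `attribute [local instance] MvPolynomial.gradedAlgebra` dropped from parts 03–05, and `structure EB … : Prop` turned into the proof-neutral `def EB … : Prop := 0 ≤ l ∧ ∀ a b, …` (the lens's 14:29Z draft form; critic L2077/L2082). `--supports stmt-Schanuel-33363`; no census credit carried; rung 0 — nothing here proves Schanuel.)
-/

noncomputable section

open Complex IntermediateField
open MvPolynomial (aeval rename X C)
open Literature.NumberTheory.Transcendental
open Literature.NumberTheory.Transcendental.Nesterenko
open Literature.Barriers.Schanuel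
open Summit.Schanuel.Schanuel.Theorems.RootDecomp1KHyper

namespace Summit.Schanuel.Schanuel.Theorems.RootDecomp1KCor52

/-- Ring homomorphisms commute with the evaluation of INTEGER polynomials. -/
private theorem ringHom_mvaeval {S T : Type*} [CommRing S] [CommRing T] [Algebra ℤ S] [Algebra ℤ T] {n : ℕ}
    (φ : S →+* T) (g : Fin n → S) (A : MvPolynomial (Fin n) ℤ) :
    φ (aeval g A) = aeval (fun i => φ (g i)) A := by
  induction A using MvPolynomial.induction_on with
  | C a => simp
  | add p r hp hr => simp only [map_add, hp, hr]
  | mul_X p i hp => simp only [map_mul, MvPolynomial.aeval_X, hp]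

/-! ## §4e  The norm step (LNM 1752 p. 47): from the measure at `ω` for `ℤ[y₁..y₄]` to the measure at `ξ`
for `ℤ[x₁,x₂,x₃]`, through `B := det 𝔄_A = 𝔇(ω)^{nD} · N_{L/K}(A(ξ))` and the product of the conjugates. -/

set_option synthInstance.maxHeartbeats 400000 in
/-- **Norm step, algebraic half.** `ω : Fin 4 → ℂ`, `K = ℚ(ω)`, `ξ : Fin 3 → ℂ` algebraically independent,
`L = K(ξ)` algebraic (hence finite, degree `D`) over `K`. There are constants `D, E, g, l, δ ≠ 0, R ≥ 1` such that
every non-zero `A ∈ ℤ[x₁,x₂,x₃]` of degree `n` has a companion `B ∈ ℤ[y₁,…,y₄]` (namely `det 𝔄_A`) with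
`B(ω) ≠ 0`, `deg B ≤ D·n·g`, `len B ≤ D!·(len A · D² (D l)ⁿ)^D` and `|B(ω)| ≤ |δ|^{nD} · |A(ξ)| · (len A · Rⁿ)^E`
(`B(ω) = δ^{nD} N_{L/K}(A(ξ))` and the norm is `A(ξ)` times the other conjugates).
[cite: NesterenkoPhilippon2001, Ch. 3, proof of Cor. 5.2 (p. 47)] -/
theorem norm_step_algebra (ω : Fin 4 → ℂ) (ξ : Fin 3 → ℂ) (hξ : AlgebraicIndependent ℚ ξ)
    (halg : Algebra.IsAlgebraic (adjoin ℚ (Set.range ω)) (adjoin (adjoin ℚ (Set.range ω)) (Set.range ξ))) :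
    ∃ (D Ec g : ℕ) (l : ℤ) (δ : ℂ) (Rb : ℝ), 1 ≤ D ∧ 1 ≤ l ∧ δ ≠ 0 ∧ 1 ≤ Rb ∧
      ∀ A : MvPolynomial (Fin 3) ℤ, A ≠ 0 → ∃ B : MvPolynomial (Fin 4) ℤ, aeval ω B ≠ 0 ∧
        B.totalDegree ≤ D * (A.totalDegree * g) ∧
        mvlen B ≤ (Nat.factorial D : ℤ) * (mvlen A * ((D : ℤ) ^ 2 * ((D : ℤ) * l) ^ A.totalDegree)) ^ D ∧
        ‖aeval ω B‖ ≤ ‖δ‖ ^ (A.totalDegree * D) *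
          (‖aeval ξ A‖ * (((mvlen A : ℤ) : ℝ) * Rb ^ A.totalDegree) ^ Ec) := by
  classical
  -- the fields `K = ℚ(ω) ⊂ L = K(ξ)`; `L/K` finite of degree `D ≥ 1`
  set K : IntermediateField ℚ ℂ := adjoin ℚ (Set.range ω) with hKdef
  set L : IntermediateField K ℂ := adjoin K (Set.range ξ) with hLdef
  haveI : Algebra.IsAlgebraic K L := halg
  have hmemL : ∀ i, ξ i ∈ L := fun i => subset_adjoin K _ ⟨i, rfl⟩
  set ξL : Fin 3 → L := fun i => ⟨ξ i, hmemL i⟩ with hξL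
  haveI hfin : FiniteDimensional K L :=
    IntermediateField.finiteDimensional_adjoin fun x hx => by
      obtain ⟨i, rfl⟩ := hx
      exact ((Algebra.IsAlgebraic.isAlgebraic (ξL i)).algebraMap (A := ℂ)).isIntegral
  have hDpos : 0 < Module.finrank K L := Module.finrank_pos
  set D := Module.finrank K L with hDdef
  have hD1 : 1 ≤ D := hDpos
  let b := Module.finBasis K L
  let ℓ := Algebra.leftMulMatrix b
  let ψ : L →+* Matrix (Fin D) (Fin D) ℂ := (algebraMap K ℂ).mapMatrix.comp ℓ.toRingHom
  have hψ : ∀ (y : L) a a', ψ y a a' = ((ℓ y) a a' : ℂ) := fun y a a' => rfl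
  have hnormdet : ∀ x : L, algebraMap K ℂ (Algebra.norm K x) = (ψ x).det := by
    intro x; rw [Algebra.norm_eq_matrix_det b x, RingHom.map_det]; rfl
  -- integer matrices `𝔊ᵢ` and the common denominator `𝔇` (all entries of `ℓ(ξᵢ)` lie in `K = ℚ(ω)`)
  obtain ⟨Dn, R, hδ0, hR⟩ := exists_common_den ω
    (fun t : Fin 3 × Fin D × Fin D => ((ℓ (ξL t.1)) t.2.1 t.2.2 : ℂ)) fun t => ((ℓ (ξL t.1)) t.2.1 t.2.2).2
  let G : Fin 3 → Matrix (Fin D) (Fin D) (MvPolynomial (Fin 4) ℤ) := fun i => Matrix.of fun a a' => R (i, a, a')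
  have hGapp : ∀ i a a', G i a a' = R (i, a, a') := fun i a a' => rfl
  have hG : ∀ i, ((aeval ω : MvPolynomial (Fin 4) ℤ →ₐ[ℤ] ℂ) : MvPolynomial (Fin 4) ℤ →+* ℂ).mapMatrix (G i) =
      aeval ω Dn • ψ (ξL i) := by
    intro i
    ext a a'
    rw [RingHom.mapMatrix_apply, Matrix.map_apply, Matrix.smul_apply, hψ, smul_eq_mul, RingHom.coe_coe, hGapp,
      ← hR (i, a, a'), mul_comm]
  -- sizes of the entries: degree `≤ g`, length `≤ l`
  set g : ℕ := ∑ t, (R t).totalDegree + Dn.totalDegree with hgdef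
  set l : ℤ := ∑ t, mvlen (R t) + mvlen Dn + 1 with hldef
  have hsumR : 0 ≤ ∑ t, mvlen (R t) := Finset.sum_nonneg fun t _ => mvlen_nonneg _
  have hDn0 := mvlen_nonneg Dn
  have hl1 : 1 ≤ l := by rw [hldef]; linarith
  have hGEB : ∀ i, EB (G i) g l := by
    intro i
    refine ⟨by linarith, fun a a' => ⟨?_, ?_⟩⟩
    · have h : (R (i, a, a')).totalDegree ≤ ∑ t, (R t).totalDegree :=
        Finset.single_le_sum (f := fun t => (R t).totalDegree) (fun t _ => Nat.zero_le _)
          (Finset.mem_univ (i, a, a'))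
      rw [hGapp, hgdef]; omega
    · have h : mvlen (R (i, a, a')) ≤ ∑ t, mvlen (R t) :=
        Finset.single_le_sum (f := fun t => mvlen (R t)) (fun t _ => mvlen_nonneg _)
          (Finset.mem_univ (i, a, a'))
      rw [hGapp, hldef]; linarith
  have hDng : Dn.totalDegree ≤ g := by rw [hgdef]; omega
  have hDnl : mvlen Dn ≤ l := by rw [hldef]; linarith
  -- the embeddings `σ : L → ℂ` over `K`, the radius `Rb ≥ max(1, |σ ξᵢ|)`, the identity embedding
  set Rb : ℝ := 1 + ∑ σ : L →ₐ[K] ℂ, ∑ i, ‖σ (ξL i)‖ with hRbdef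
  have hRb0 : 0 ≤ ∑ σ : L →ₐ[K] ℂ, ∑ i, ‖σ (ξL i)‖ :=
    Finset.sum_nonneg fun σ _ => Finset.sum_nonneg fun i _ => norm_nonneg _
  have hRb1 : 1 ≤ Rb := by rw [hRbdef]; linarith
  have hσle : ∀ (σ : L →ₐ[K] ℂ) i, ‖σ (ξL i)‖ ≤ Rb := by
    intro σ i
    have h1 : ‖σ (ξL i)‖ ≤ ∑ j, ‖σ (ξL j)‖ :=
      Finset.single_le_sum (f := fun j => ‖σ (ξL j)‖) (fun j _ => norm_nonneg _) (Finset.mem_univ i)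
    have h2 : ∑ j, ‖σ (ξL j)‖ ≤ ∑ τ : L →ₐ[K] ℂ, ∑ j, ‖τ (ξL j)‖ :=
      Finset.single_le_sum (f := fun τ : L →ₐ[K] ℂ => ∑ j, ‖τ (ξL j)‖)
        (fun τ _ => Finset.sum_nonneg fun j _ => norm_nonneg _) (Finset.mem_univ σ)
    rw [hRbdef]; linarith
  set Ec : ℕ := (Finset.univ.erase (IntermediateField.val L)).card with hEcdef
  refine ⟨D, Ec, g, l, aeval ω Dn, Rb, hD1, hl1, hδ0, hRb1, fun A hA => ?_⟩
  set n := A.totalDegree with hndef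
  -- the element `x = A(ξ) ∈ L`, non-zero by the algebraic independence of `ξ`
  set x : L := aeval ξL A with hxdef
  have hxval : (x : ℂ) = aeval ξ A := by
    change algebraMap L ℂ (aeval ξL A) = _
    rw [ringHom_mvaeval]
    rfl
  have hAξ : aeval ξ A ≠ 0 := by
    intro h
    apply hA
    have h1 : MvPolynomial.map (Int.castRingHom ℚ) A = 0 :=
      algebraicIndependent_iff.mp hξ _ (by rwa [mvaeval_int_map])
    exact MvPolynomial.map_injective _ Int.cast_injective (by rw [h1, map_zero])
  have hx0 : x ≠ 0 := by
    intro h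
    apply hAξ
    rw [← hxval, h]
    rfl
  -- `B := det 𝔄_A`, `B(ω) = δ^{nD} · N_{L/K}(x) ≠ 0`
  have hBval : aeval ω (matA G Dn A).det = aeval ω Dn ^ (n * D) * algebraMap K ℂ (Algebra.norm K x) := by
    have h1 : aeval ω (matA G Dn A).det =
        ((aeval ω : MvPolynomial (Fin 4) ℤ →ₐ[ℤ] ℂ) : MvPolynomial (Fin 4) ℤ →+* ℂ) (matA G Dn A).det := rfl
    rw [h1, RingHom.map_det, mapMatrix_matA ω ψ ξL G Dn hG A, Matrix.det_smul, Fintype.card_fin, hnormdet,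
      ← pow_mul]
  have hN0 : Algebra.norm K x ≠ 0 := Algebra.norm_ne_zero_iff.mpr hx0
  have hB0 : aeval ω (matA G Dn A).det ≠ 0 := by
    rw [hBval]
    exact mul_ne_zero (pow_ne_zero _ hδ0) ((map_ne_zero _).mpr hN0)
  obtain ⟨hBdeg, hBlen⟩ := det_matA_bounds hD1 hl1 hGEB hDng hDnl A
  refine ⟨(matA G Dn A).det, hB0, hBdeg, hBlen, ?_⟩
  -- `|B(ω)| = |δ|^{nD} · Π_σ |σ x| ≤ |δ|^{nD} · |A(ξ)| · (len(A) Rb^n)^{Ec}`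
  have hσx : ∀ σ : L →ₐ[K] ℂ, ‖σ x‖ ≤ ((mvlen A : ℤ) : ℝ) * Rb ^ n := by
    intro σ
    have h := ringHom_mvaeval (σ : L →+* ℂ) ξL A
    simp only [RingHom.coe_coe] at h
    rw [hxdef, h]
    exact RootDecomp1KRelLiouvilleCell.norm_mvaeval_le_mvlen_mul_pow A _ hRb1 (hσle σ) le_rfl
  have hv : ‖(IntermediateField.val L) x‖ = ‖aeval ξ A‖ := by rw [← hxval]; rfl
  have hsplit : ∏ σ : L →ₐ[K] ℂ, ‖σ x‖ =
      ‖aeval ξ A‖ * ∏ σ ∈ Finset.univ.erase (IntermediateField.val L), ‖σ x‖ := by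
    rw [← Finset.mul_prod_erase Finset.univ (fun σ : L →ₐ[K] ℂ => ‖σ x‖)
      (Finset.mem_univ (IntermediateField.val L)), ← hv]
  have hprod : ‖algebraMap K ℂ (Algebra.norm K x)‖ ≤ ‖aeval ξ A‖ * (((mvlen A : ℤ) : ℝ) * Rb ^ n) ^ Ec := by
    rw [Algebra.norm_eq_prod_embeddings K ℂ x, norm_prod, hsplit]
    refine mul_le_mul_of_nonneg_left ?_ (norm_nonneg _)
    calc ∏ σ ∈ Finset.univ.erase (IntermediateField.val L), ‖σ x‖
        ≤ ∏ _σ ∈ Finset.univ.erase (IntermediateField.val L), ((mvlen A : ℤ) : ℝ) * Rb ^ n :=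
          Finset.prod_le_prod (fun σ _ => norm_nonneg _) fun σ _ => hσx σ
      _ = (((mvlen A : ℤ) : ℝ) * Rb ^ n) ^ Ec := by rw [Finset.prod_const]
  rw [hBval, norm_mul, norm_pow]
  exact mul_le_mul_of_nonneg_left hprod (pow_nonneg (norm_nonneg _) _)

end Summit.Schanuel.Schanuel.Theorems.RootDecomp1KCor52

end
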